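import Mathlib
import HarnessLib
import Summits.QuantumFields.YangMills.Theses.ScalingWindowSplit
import Summits.QuantumFields.YangMills.Theorems.ScalingWindowSplitExistenceLegFromLatticeR
import Summits.QuantumFields.YangMills.Theorems.SelfNormalisedMomentBounds.Negative.SelfNormalisedMomentBoundsFalseOfTwoRateWindowScheme

/-!
# Crux `SelfNormalisedMomentBoundsR` (stmt-QuantumFields-18014) — strategist workfile `MaskedSectorObstruction.lean`

Crux-strategist BEFORE the lead (`cstrat-stmt-QuantumFields-18014-b1`, 2026-08-17) on crux U_R =
`ScalingWindowSplit.SelfNormalisedMomentBoundsR` of route `ScalingWindowSplit` (rev 7).  Companion of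
`STRATEGY-CENSUS.md` (same crux directory).  Kernel-checked content, in three parts:

**Part A — negation lens: U_R still forces ONE decorrelation rate (the rev-6 repair did not remove the two-rate
vulnerability, only its perverse-window inhabitant).**  `rate_rigidity_of_selfNormalisedMomentBoundsR`: U_R ⇒ for every
admissible datum `(G, r, sch, u, p, M)` — weak coupling, polynomial volumes, PAST-SUPPORTED `u`, floor and window — and
every real test `v` with `tsupport v ∩ tsupport θv = ∅`, eventually `|T⁰_k(v,θv)| ≤ B · T⁰_k(u,θu)` (proof = the refuter's
`rate_rigidity_of_selfNormalisedMomentBounds` with the token `hu` threaded).  `TwoRateHonestWindowScheme` (`H_R`) = the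
refuter's `TwoRateWindowScheme` PLUS the past-support clause; `selfNormalisedMomentBoundsR_false_of_twoRateHonestWindowScheme :
H_R → ¬ U_R`.  NEW INHABITANT (physics-grade, census §1): the MASKED PRODUCT GROUP `G = U(1) × SU(2)`, `r = e^{iθ} ⊕ V`
(faithful, 3-dimensional; Wilson's measure FACTORISES, the plaquette field is the SUM of the two independent sectors, so
`T⁰ = T⁰_{U(1)} + T⁰_{SU(2)}`): along `β_k ↑ ∞`, `a_k := 1/(2 ξ_{SU(2)}(β_k) log β_k)` (the non-abelian confinement scale
`ε_k = a_k ξ_{SU(2)}(β_k) = 1/(2 log β_k)` collapses logarithmically UNDER the abelian power law, which carries floor and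
window at an honest bump `u` at time-distance `> 1/2` from the hyperplane), the reflected pair of a bump `v` at
time-distance `d₀ < 1/2` has `T⁰_k(v,θv)/T⁰_k(u,θu) ≍ β_k^{2-4d₀} (log β_k)⁸ → ∞`: the `β_k²` is ASYMPTOTIC FREEDOM (the
`SU(2)` plaquette two-point function at its own confinement scale is `≍ ξ^{-8}` with a `β`-INDEPENDENT constant — running
coupling `O(1)` there — while the abelian one stays `≍ β^{-2} n^{-8}`).  So U_R as typed (`∀` compact `G`) is refuted by the
conjunction of (P1) Coulomb control of Wilson-`U(1)₄` plaquette correlations and (P2) scaling + mass gap + Ornstein–Zernike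
control for `SU(2)₄` — i.e. by the EXPECTED answer to the Clay problem for `SU(2)`.  Rigorous today: this file.  Repair:
restrict U_R to the Statement's `IsCompactSimpleLieGroup G` (Part B).

**Part B — the repair is glue-compatible.**  `SelfNormalisedMomentBoundsRS` (U_RS) := U_R with `IsCompactSimpleLieGroup G →`
inserted after the instance binders (character-identical otherwise); `selfNormalisedMomentBoundsRS_of_R : U_R → U_RS`;
`existenceLegFromLatticeRS : W₁ → W₂ → U_RS → CoincidenceRotationBootstrap.HypercubicLimit` (= the landed
`existenceLegFromLatticeR_proof` with ONE more token `hG`); `closesRS : W₁ → U_RS → CurvatureAmnesia → W₂ → EuclideanUpgrade →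
YangMills` (= the route's `closes` re-pointed).  A tenure/repair planner can file U_RS + `ExistenceLegFromLatticeRS` and
re-certify `closes` from these proofs verbatim.

**Part C — census signatures (not filed; U_RS is not the crux BY NAME, so no skeleton can be registered for it).**
D1 ORDER SPLIT: `TwoPointEnvelopeS` (the `n = 2` piece: the self-normalised plane fields have `k`-uniformly bounded
two-point functions on normalised plane-wise disjoint pairs — NECESSARY, and already the ultraviolet kernel in its
scaling-dimension form) and the remainder `TwoPointEnvelopeS → U_RS` (all orders from two: no correlation inequality of
Newman/Gaussian type exists for a non-abelian `G`; as an analytic statement it is the whole kernel) — `selfNormalisedMomentBoundsRS_of_D1`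
is modus ponens.  D2 TRANSFER TO THE 16154 CURRENCY: `CanonResponseDerivBounds` (`k`-uniform bounds on all derivatives at `0`
of the anisotropic order-one tilted responses of the SELF-NORMALISED scheme) ⇒ U_RS by the landed
`stub_derivToMomentsPlanes` (`selfNormalisedMomentBoundsRS_of_canonResponseDerivBounds`, proved): a strictly STRONGER
statement (repeated insertions in one region = contact terms / the `F² × F² → F²` OPE channel, which U_RS's pairwise
disjointness avoids) whose own proof needs the same multiscale expansion — no leverage, recorded as the typed form of the
route header's "alternatively U ⇐ ResponseHolomorphyOnePlanes for canon".

No `sorry`.  Nothing here restates, weakens or replaces the crux; U_RS is a PROPOSAL for the route planner.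
-/

noncomputable section

open scoped SchwartzMap BigOperators Topology
open MeasureTheory ProbabilityTheory Filter Topology
open Literature.MathematicalPhysics.AQFT Literature.MathematicalPhysics.QuantumLattice
open Literature.MathematicalPhysics.QuantumFieldTheory
open Summit.QuantumFields.YangMills.Cruxes.HypercubicLimit.CouplingResponse
open Summit.QuantumFields.YangMills.Theorems.ScalingWindowSplit (trunc_rescale trunc_eq_covariance
  oneField_of_latticeInequalities)
open Summit.QuantumFields.YangMills.Theorems.SelfNormalisedMomentBounds.Negative (trunc_smul TwoRateWindowScheme)

namespace Summit.QuantumFields.YangMills.Cruxes.SelfNormalisedMomentBoundsR.Strategist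

/-! ## Part A — negation lens: one decorrelation rate, also with the honest (past-supported) window -/

section PartA

variable {G : Type} [Group G] [TopologicalSpace G] [IsTopologicalGroup G] [CompactSpace G]
  [MeasurableSpace G] [BorelSpace G]

/-- **U_R forces ONE decorrelation rate.**  If `SelfNormalisedMomentBoundsR` holds then, at every admissible datum
`(G, r, sch, u, p, M)` of U_R (weak coupling, polynomial volumes, `u` supported at negative times, floor and window at
`u`) and for every real test `v` whose support is disjoint from that of `θv`, the bare truncated two-point function of
the reflected pair `(v, θv)` is eventually dominated by that of the reference pair: `|T⁰_k(v,θv)| ≤ B · T⁰_k(u,θu)`.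
Proof: verbatim the refuter's `rate_rigidity_of_selfNormalisedMomentBounds` (U at orders one and two for the
self-normalised scheme `canon`, `c'_k² = 1/T⁰_k(u,θu)`, seam identities `trunc_rescale`/`trunc_smul`) with the
past-support token `hu` fed to U_R. [folklore] -/
theorem rate_rigidity_of_selfNormalisedMomentBoundsR
    (hU : Summit.QuantumFields.YangMills.Theses.ScalingWindowSplit.SelfNormalisedMomentBoundsR)
    (r : LatticeRep G) (sch : SpeciesScheme (YMSpecies G))
    (u v : 𝓢(EuclideanSpace ℝ (Fin 4), ℝ)) (p : ℕ) (M : ℝ) :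
    let bare : SpeciesScheme (YMSpecies G) := { sch with c := fun _ _ => 1, m := fun _ _ => 0 }
    let T : 𝓢(EuclideanSpace ℝ (Fin 4), ℝ) → ℕ → ℝ := fun w k =>
      latticeSchwinger r.ρ bare (fun s => s.F) k (1 + 1) (fun _ => r.curvature) ![w, thetaTest 4 w] -
        latticeSchwinger r.ρ bare (fun s => s.F) k 1 (fun _ => r.curvature) ![w] *
          latticeSchwinger r.ρ bare (fun s => s.F) k 1 (fun _ => r.curvature) ![thetaTest 4 w]
    sch.HasWeakCouplingLimit →
    (∃ N : ℕ, 1 ≤ N ∧ ∀ᶠ k in Filter.atTop, (sch.a k)⁻¹ ≤ (sch.a k * (sch.L k : ℝ)) ^ N) →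
    tsupport u ⊆ {y : EuclideanSpace ℝ (Fin 4) | y 0 < 0} →
    (∀ᶠ k in Filter.atTop, (sch.a k) ^ p ≤ T u k ∧ T u k ≤ M * T (timeShiftTest 4 (-1) u) k) →
    Disjoint (tsupport v) (tsupport (thetaTest 4 v)) →
    ∃ B : ℝ, ∀ᶠ k in Filter.atTop, |T v k| ≤ B * T u k := by
  intro bare T hw hpv hu hfw hdisj
  -- the self-normalised scheme of U_R
  let canon : SpeciesScheme (YMSpecies G) :=
    { sch with
      c := fun _ k => (Real.sqrt (T u k))⁻¹
      m := fun _ k => ∫ U, r.curvature.F (torusLift (sch.side k) U) ∂(wilsonMeasure r.ρ (sch.β k)) }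
  -- U_R at the datum: the (inlined) plane-resolved moment bounds of `canon`, re-folded by `Iff.rfl`
  have hP : UniformMomentBoundsPlanes r canon := hU G r sch u p M hw hpv hu hfw
  -- planes ⇒ curvature strings (landed)
  obtain ⟨s, C₀, C₁, hb⟩ := uniformMomentBounds_of_planes G r canon hP
  -- the normalised reflected pair
  set N₁ : ℝ := schwartzNorm s (ofRealTest v) with hN₁
  set N₂ : ℝ := schwartzNorm s (ofRealTest (thetaTest 4 v)) with hN₂
  have hN₁0 : 0 ≤ N₁ := schwartzNorm_nonneg _ _
  have hN₂0 : 0 ≤ N₂ := schwartzNorm_nonneg _ _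
  set l₁ : ℝ := (N₁ + 1)⁻¹ with hl₁
  set l₂ : ℝ := (N₂ + 1)⁻¹ with hl₂
  have hl₁0 : 0 < l₁ := inv_pos.2 (by linarith)
  have hl₂0 : 0 < l₂ := inv_pos.2 (by linarith)
  set v₁ : 𝓢(EuclideanSpace ℝ (Fin 4), ℝ) := l₁ • v with hv₁
  set v₂ : 𝓢(EuclideanSpace ℝ (Fin 4), ℝ) := l₂ • thetaTest 4 v with hv₂
  have hn₁ : schwartzNorm s (ofRealTest v₁) ≤ 1 := by
    rw [hv₁, schwartzNorm_ofRealTest_smul, abs_of_pos hl₁0, ← hN₁, hl₁]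
    rw [inv_mul_le_iff₀ (by linarith : (0 : ℝ) < N₁ + 1)]
    linarith
  have hn₂ : schwartzNorm s (ofRealTest v₂) ≤ 1 := by
    rw [hv₂, schwartzNorm_ofRealTest_smul, abs_of_pos hl₂0, ← hN₂, hl₂]
    rw [inv_mul_le_iff₀ (by linarith : (0 : ℝ) < N₂ + 1)]
    linarith
  have hd₁₂ : Disjoint (tsupport (v₁ : EuclideanSpace ℝ (Fin 4) → ℝ))
      (tsupport (v₂ : EuclideanSpace ℝ (Fin 4) → ℝ)) :=
    hdisj.mono (tsupport_smul_subset_right (fun _ => l₁) _) (tsupport_smul_subset_right (fun _ => l₂) _)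
  -- U_R at orders two and one
  have h2 := fun k => hb (1 + 1) ![v₁, v₂]
    (by
      intro i
      fin_cases i
      · simpa using hn₁
      · simpa using hn₂)
    (by
      intro i j hij
      fin_cases i <;> fin_cases j
      · exact absurd rfl hij
      · simpa using hd₁₂
      · simpa using hd₁₂.symm
      · exact absurd rfl hij) k
  have h1 := fun k => hb 1 ![v₁] (by intro i; fin_cases i; simpa using hn₁)
    (by intro i j hij; exact absurd (Subsingleton.elim i j) hij) k
  have h1' := fun k => hb 1 ![v₂] (by intro i; fin_cases i; simpa using hn₂)
    (by intro i j hij; exact absurd (Subsingleton.elim i j) hij) k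
  -- the seam: `𝔖₂^canon − 𝔖₁^canon 𝔖₁^canon = c'_k² · l₁ l₂ · T⁰_k(v, θv)`
  have hseam : ∀ k,
      latticeSchwinger r.ρ canon (fun s => s.F) k (1 + 1) (fun _ => r.curvature) ![v₁, v₂] -
          latticeSchwinger r.ρ canon (fun s => s.F) k 1 (fun _ => r.curvature) ![v₁] *
            latticeSchwinger r.ρ canon (fun s => s.F) k 1 (fun _ => r.curvature) ![v₂] =
        canon.c r.curvature k ^ 2 * (l₁ * l₂ * T v k) := by
    intro k
    rw [trunc_rescale r canon k v₁ v₂, hv₁, hv₂, trunc_smul]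
  -- the uniform bound on the tail
  set A₁ : ℝ := C₀ * C₁ ^ 1 * (Nat.factorial 1 : ℕ) with hA₁
  set A₂ : ℝ := C₀ * C₁ ^ (1 + 1) * (Nat.factorial (1 + 1) : ℕ) with hA₂
  set B₀ : ℝ := A₂ + A₁ * A₁ with hB₀
  refine ⟨B₀ / (l₁ * l₂), hfw.mono fun k hk => ?_⟩
  have hTpos : 0 < T u k := (pow_pos (sch.a_pos k) p).trans_le hk.1
  have hc : canon.c r.curvature k ^ 2 = (T u k)⁻¹ := by
    show ((Real.sqrt (T u k))⁻¹) ^ 2 = (T u k)⁻¹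
    rw [inv_pow, Real.sq_sqrt hTpos.le]
  have hA₁0 : 0 ≤ A₁ := (abs_nonneg _).trans (h1 k)
  -- |𝔖₂ − 𝔖₁𝔖₁| ≤ A₂ + A₁²
  have hkey : |(T u k)⁻¹ * (l₁ * l₂ * T v k)| ≤ B₀ := by
    rw [← hc, ← hseam k]
    refine (abs_sub _ _).trans (add_le_add (h2 k) ?_)
    rw [abs_mul]
    exact mul_le_mul (h1 k) (h1' k) (abs_nonneg _) hA₁0
  rw [abs_mul, abs_mul, abs_of_pos (inv_pos.2 hTpos), abs_of_pos (mul_pos hl₁0 hl₂0)] at hkey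
  -- unwind: |T v k| ≤ (B₀ / (l₁ l₂)) · T u k
  have hll : 0 < l₁ * l₂ := mul_pos hl₁0 hl₂0
  rw [div_mul_eq_mul_div, le_div_iff₀ hll]
  have := mul_le_mul_of_nonneg_left hkey hTpos.le
  calc |T v k| * (l₁ * l₂) = T u k * ((T u k)⁻¹ * (l₁ * l₂ * |T v k|)) := by
        field_simp
    _ ≤ T u k * B₀ := this
    _ = B₀ * T u k := mul_comm _ _

end PartA

/-- **`H_R` — a TWO-RATE HONEST-WINDOW SCHEME** (hypothesis of the negative lemma; not constructible in the tree).
The refuter's `TwoRateWindowScheme` WITH the past-support clause of the repaired crux: some compact `G`, faithful `r`,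
Wilson scheme `sch`, bump `u` SUPPORTED AT NEGATIVE TIMES, `p`, `M` meet exactly the five hypotheses of U_R (weak
coupling, polynomial volumes, past support, polynomial floor and window at `u`), and some real test `v` with
`tsupport v ∩ tsupport θv = ∅` has its bare truncated reflected two-point function infinitely often larger than any
multiple of the reference one: `∀ B, ∃ᶠ k, B · T⁰_k(u,θu) < |T⁰_k(v,θv)|`.  Intended inhabitant (census §1, physics-grade):
the MASKED PRODUCT GROUP `U(1) × SU(2)` with `r = e^{iθ} ⊕ V`, `a_k = 1/(2 ξ_{SU(2)}(β_k) log β_k)`, `u` a bump at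
time-distance `> 1/2` from the hyperplane, `v` a bump at time-distance `< 1/2` — conditionally on Coulomb control of
Wilson-`U(1)₄` (Guth 1980; Fröhlich–Spencer 1982; Driver 1987 for Villain) and on scaling + gap + Ornstein–Zernike control of
`SU(2)₄` at its confinement scale with `β`-independent constants (asymptotic freedom / dimensional transmutation;
Montvay–Münster (3.266)–(3.267), (3.435); Collins–Duncan–Joglekar 1977) — the expected Clay behaviour of `SU(2)`, open.
A HYPOTHESIS (no citation tag on purpose). -/
def TwoRateHonestWindowScheme : Prop :=
  ∃ (G : Type) (_ : Group G) (_ : TopologicalSpace G) (_ : IsTopologicalGroup G) (_ : CompactSpace G)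
    (_ : MeasurableSpace G) (_ : BorelSpace G) (r : LatticeRep G) (sch : SpeciesScheme (YMSpecies G))
    (u v : 𝓢(EuclideanSpace ℝ (Fin 4), ℝ)) (p : ℕ) (M : ℝ),
    let bare : SpeciesScheme (YMSpecies G) := { sch with c := fun _ _ => 1, m := fun _ _ => 0 }
    let T : 𝓢(EuclideanSpace ℝ (Fin 4), ℝ) → ℕ → ℝ := fun w k =>
      latticeSchwinger r.ρ bare (fun s => s.F) k (1 + 1) (fun _ => r.curvature) ![w, thetaTest 4 w] -
        latticeSchwinger r.ρ bare (fun s => s.F) k 1 (fun _ => r.curvature) ![w] *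
          latticeSchwinger r.ρ bare (fun s => s.F) k 1 (fun _ => r.curvature) ![thetaTest 4 w]
    sch.HasWeakCouplingLimit ∧
    (∃ N : ℕ, 1 ≤ N ∧ ∀ᶠ k in Filter.atTop, (sch.a k)⁻¹ ≤ (sch.a k * (sch.L k : ℝ)) ^ N) ∧
    tsupport u ⊆ {y : EuclideanSpace ℝ (Fin 4) | y 0 < 0} ∧
    (∀ᶠ k in Filter.atTop, (sch.a k) ^ p ≤ T u k ∧ T u k ≤ M * T (timeShiftTest 4 (-1) u) k) ∧
    Disjoint (tsupport v) (tsupport (thetaTest 4 v)) ∧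
    ∀ B : ℝ, ∃ᶠ k in Filter.atTop, B * T u k < |T v k|

/-- `H_R ⊆ H`: an honest-window two-rate scheme is in particular a two-rate scheme of the refuter's hypothesis (drop
the past-support clause) — so everything the held negative lemma's docstring expects of `H` transfers, and the rev-6
repair narrowed the class of inhabitants without emptying it. [folklore] -/
theorem twoRateWindowScheme_of_honest (h : TwoRateHonestWindowScheme) : TwoRateWindowScheme := by
  obtain ⟨G, i₁, i₂, i₃, i₄, i₅, i₆, r, sch, u, v, p, M, hw, hpv, _hu, hfw, hdisj, hrate⟩ := h
  exact ⟨G, i₁, i₂, i₃, i₄, i₅, i₆, r, sch, u, v, p, M, hw, hpv, hfw, hdisj, hrate⟩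

/-- **Negative lemma modulo `H_R`: a two-rate honest-window scheme refutes U_R as typed.**
`TwoRateHonestWindowScheme → ¬ SelfNormalisedMomentBoundsR`: at the datum of `H_R`, U_R's rate rigidity
(`rate_rigidity_of_selfNormalisedMomentBoundsR`) gives `|T⁰_k(v,θv)| ≤ B · T⁰_k(u,θu)` eventually, contradicting the
second rate infinitely often.  Class (on paper): refuted-misstated — U_R quantifies over ALL compact `G`; the masked
product group `U(1) × SU(2)` is the expected inhabitant of `H_R`; the repaired statement `SelfNormalisedMomentBoundsRS`
(Part B) adds `IsCompactSimpleLieGroup G →`, which the Statement supplies and which no product/abelian-factor group meets.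
[folklore] -/
theorem selfNormalisedMomentBoundsR_false_of_twoRateHonestWindowScheme :
    TwoRateHonestWindowScheme →
      ¬ Summit.QuantumFields.YangMills.Theses.ScalingWindowSplit.SelfNormalisedMomentBoundsR := by
  rintro ⟨G, _, _, _, _, _, _, r, sch, u, v, p, M, hw, hpv, hu, hfw, hdisj, hrate⟩ hU
  obtain ⟨B, hB⟩ := rate_rigidity_of_selfNormalisedMomentBoundsR hU r sch u v p M hw hpv hu hfw hdisj
  obtain ⟨k, hk₁, hk₂⟩ := ((hrate B).and_eventually hB).exists
  exact absurd hk₁ (not_lt.2 hk₂)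

/-! ## Part B — the proposed repair U_RS (simple `G`) and its glue -/

/-- **U_RS — `SelfNormalisedMomentBoundsR` restricted to compact SIMPLE Lie groups** (PROPOSAL for the route planner;
character-identical to the crux except for the inserted hypothesis `IsCompactSimpleLieGroup G →`, which the Statement
`YangMills` and the consumer `HypercubicLimit` both carry).  It escapes the masked-sector witness of Part A (no abelian
factor, one running coupling) and is what the route's rationale actually argues for. [folklore] -/
def SelfNormalisedMomentBoundsRS : Prop :=
  open Literature.MathematicalPhysics.QuantumLattice Literature.MathematicalPhysics.AQFT Literature.MathematicalPhysics.QuantumFieldTheory in let E := EuclideanSpace ℝ (Fin 4); ∀ (G : Type) [Group G] [TopologicalSpace G] [IsTopologicalGroup G] [CompactSpace G] [MeasurableSpace G] [BorelSpace G], IsCompactSimpleLieGroup G → ∀ (r : LatticeRep G) (sch : SpeciesScheme (YMSpecies G)) (u : SchwartzMap E ℝ) (p : ℕ) (M : ℝ), let bare : SpeciesScheme (YMSpecies G) := { sch with c := fun _ _ => 1, m := fun _ _ => 0 }; let T : SchwartzMap E ℝ → ℕ → ℝ := fun w k => latticeSchwinger r.ρ bare (fun s => s.F) k (1 + 1) (fun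 _ => r.curvature) ![w, thetaTest 4 w] - latticeSchwinger r.ρ bare (fun s => s.F) k 1 (fun _ => r.curvature) ![w] * latticeSchwinger r.ρ bare (fun s => s.F) k 1 (fun _ => r.curvature) ![thetaTest 4 w]; let canon : SpeciesScheme (YMSpecies G) := { sch with c := fun _ k => (Real.sqrt (T u k))⁻¹, m := fun _ k => ∫ U, r.curvature.F (torusLift (sch.side k) U) ∂(wilsonMeasure r.ρ (sch.β k)) }; sch.HasWeakCouplingLimit → (∃ N : ℕ, 1 ≤ N ∧ ∀ᶠ k in Filter.atTop, (sch.a k)⁻¹ ≤ (sch.a k * (sch.L k : ℝ)) ^ N) → tsupport u ⊆ {y : E | y 0 < 0} → (∀ᶠ k in Filter.atTop, (sch.a k) ^ p ≤ T u k ∧ T u k ≤ M * T (timeShiftTest 4 (-1) u) k) → ∃ (s : ℕ) (C₀ C₁ : ℝ), ∀ (n : ℕ) (F : Fin n → {q : Fin 4 × Fin 4 // q.1 < q.2} → SchwartzMap E ℝ), (∀ i, ∑ q, schwartzNorm s (ofRealTest (F i q)) ≤ 1) → (∀ i j, i ≠ j → ∀ q q', Disjoint (tsupport (F i q)) (tsupport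 (F j q'))) → ∀ k : ℕ, |∫ U, ∏ i, ∑ q : {q : Fin 4 × Fin 4 // q.1 < q.2}, smearedLatticeField (plaquetteObs r.ρ 0 q.1.1 q.1.2) (Literature.Probability.LatticeModels.box 4 (canon.L k)) (canon.a k) (canon.c r.curvature k) (canon.m r.curvature k / 6) (F i q) (torusLift (canon.side k) U) ∂(wilsonMeasure r.ρ (canon.β k) : Measure (GaugeConfig 4 (canon.side k) G))| ≤ C₀ * C₁ ^ n * n.factorial

/-- U_R (all compact `G`) trivially implies U_RS (simple `G` only). [folklore] -/
theorem selfNormalisedMomentBoundsRS_of_R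
    (hU : Summit.QuantumFields.YangMills.Theses.ScalingWindowSplit.SelfNormalisedMomentBoundsR) :
    SelfNormalisedMomentBoundsRS := by
  intro G _ _ _ _ _ _ _hG r sch u p M
  exact hU G r sch u p M

/-- **The typed split re-pointed at U_RS**: `GapAtCorrelationLength → SelfNormalisedSkewness → U_RS →
CoincidenceRotationBootstrap.HypercubicLimit` — literally the landed `existenceLegFromLatticeR_proof` with ONE more
token, the simplicity hypothesis `hG` of the consumer fed to U_RS. [cite: GlimmJaffe1987, §6.1 and §19.1] -/
theorem existenceLegFromLatticeRS
    (hW : Summit.QuantumFields.YangMills.Theses.ScalingWindowSplit.GapAtCorrelationLength)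
    (hS : Summit.QuantumFields.YangMills.Theses.ScalingWindowSplit.SelfNormalisedSkewness)
    (hU : SelfNormalisedMomentBoundsRS) :
    Summit.QuantumFields.YangMills.Theses.CoincidenceRotationBootstrap.HypercubicLimit := by
  refine Summit.QuantumFields.YangMills.Theorems.HypercubicLimit.OneFieldWeak.hypercubicLimit_iff_oneFieldWeak.mpr
    fun G _ _ _ _ hG => ?_
  letI : MeasurableSpace G := borel G
  haveI : BorelSpace G := ⟨rfl⟩
  obtain ⟨r, sch, u, p, M, Δ, C, hw, hpv, hΔ, hgap, hrp, hu, hfw⟩ := hW G hG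
  obtain ⟨sch', S₁, hw', h₁⟩ := oneField_of_latticeInequalities r sch u p M Δ C hw hpv hΔ hgap hrp hu hfw
    (hU G hG r sch u p M hw hpv hu hfw) (hS G r sch u p M hw hpv hu hfw)
  exact ⟨r, sch', S₁, hw', h₁⟩

/-- **The route's deciding theorem re-pointed at U_RS** (what `closes` becomes after the restate): W₁, U_RS, the shared
crux `CurvatureAmnesia`, W₂ and the proved support `EuclideanUpgrade` give `YangMills`, through the parent's
`CoincidenceRotationBootstrap.closes`. [folklore] -/
theorem closesRS
    (hW : Summit.QuantumFields.YangMills.Theses.ScalingWindowSplit.GapAtCorrelationLength)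
    (hU : SelfNormalisedMomentBoundsRS)
    (hA : Summit.QuantumFields.YangMills.Theses.ScalingWindowSplit.CurvatureAmnesia)
    (hS : Summit.QuantumFields.YangMills.Theses.ScalingWindowSplit.SelfNormalisedSkewness)
    (hUpg : Summit.QuantumFields.YangMills.Theses.ScalingWindowSplit.EuclideanUpgrade) : YangMills :=
  Summit.QuantumFields.YangMills.Theses.CoincidenceRotationBootstrap.closes hA (existenceLegFromLatticeRS hW hS hU) hUpg

/-! ## Part C — census signatures for the repaired crux (typed splits; nothing filed) -/

/-- **D1(a) TWO-POINT ENVELOPE (the `n = 2` piece of U_RS)**: under U_RS's hypotheses the plane fields of the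
self-normalised scheme have `k`-uniformly bounded two-point functions on normalised, plane-wise disjoint pairs — the
reference reflected pair is, up to constants, the largest covariance scale.  NECESSARY for U_RS (the order-two case,
exactly as in rate rigidity) and already an ultraviolet statement (a scaling-dimension UPPER bound for `tr F²` uniformly
in `k`: short-distance correlations bounded above — reflection positivity bounds them only from below). [folklore] -/
def TwoPointEnvelopeS : Prop :=
  open Literature.MathematicalPhysics.QuantumLattice Literature.MathematicalPhysics.AQFT Literature.MathematicalPhysics.QuantumFieldTheory in let E := EuclideanSpace ℝ (Fin 4); ∀ (G : Type) [Group G] [TopologicalSpace G] [IsTopologicalGroup G] [CompactSpace G] [MeasurableSpace G] [BorelSpace G], IsCompactSimpleLieGroup G → ∀ (r : LatticeRep G) (sch : SpeciesScheme (YMSpecies G)) (u : SchwartzMap E ℝ) (p : ℕ) (M : ℝ), let bare : SpeciesScheme (YMSpecies G) := { sch with c := fun _ _ => 1, m := fun _ _ => 0 }; let T : SchwartzMap E ℝ → ℕ → ℝ := fun w k => latticeSchwinger r.ρ bare (fun s => s.F) k (1 + 1) (fun _ => r.curvature) ![w, thetaTest 4 w] - latticeSchwinger r.ρ bare (fun s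 => s.F) k 1 (fun _ => r.curvature) ![w] * latticeSchwinger r.ρ bare (fun s => s.F) k 1 (fun _ => r.curvature) ![thetaTest 4 w]; let canon : SpeciesScheme (YMSpecies G) := { sch with c := fun _ k => (Real.sqrt (T u k))⁻¹, m := fun _ k => ∫ U, r.curvature.F (torusLift (sch.side k) U) ∂(wilsonMeasure r.ρ (sch.β k)) }; sch.HasWeakCouplingLimit → (∃ N : ℕ, 1 ≤ N ∧ ∀ᶠ k in Filter.atTop, (sch.a k)⁻¹ ≤ (sch.a k * (sch.L k : ℝ)) ^ N) → tsupport u ⊆ {y : E | y 0 < 0} → (∀ᶠ k in Filter.atTop, (sch.a k) ^ p ≤ T u k ∧ T u k ≤ M * T (timeShiftTest 4 (-1) u) k) → ∃ (s : ℕ) (B : ℝ), ∀ (F₁ F₂ : {q : Fin 4 × Fin 4 // q.1 < q.2} → SchwartzMap E ℝ), (∑ q, schwartzNorm s (ofRealTest (F₁ q)) ≤ 1) → (∑ q, schwartzNorm s (ofRealTest (F₂ q)) ≤ 1) → (∀ q q', Disjoint (tsupport (F₁ q)) (tsupport (F₂ q'))) → ∀ k : ℕ, |∫ U, Summit.QuantumFields.YangMills.Cruxes.HypercubicLimit.CouplingResponse.fieldP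 r canon k F₁ U * Summit.QuantumFields.YangMills.Cruxes.HypercubicLimit.CouplingResponse.fieldP r canon k F₂ U ∂(Summit.QuantumFields.YangMills.Cruxes.HypercubicLimit.CouplingResponse.wilsonAt r canon k)| ≤ B

/-- **D1 assembled is modus ponens**: the remainder `TwoPointEnvelopeS → U_RS` ("all orders from two") is the piece that
stays the whole kernel — there is no Gaussian/Newman-type correlation inequality for a non-abelian compact `G`, so the
only route from two-point control to `n!`-moment bounds is the multiscale cluster expansion itself. [folklore] -/
theorem selfNormalisedMomentBoundsRS_of_D1 (h₁ : TwoPointEnvelopeS) (h₂ : TwoPointEnvelopeS → SelfNormalisedMomentBoundsRS) :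
    SelfNormalisedMomentBoundsRS :=
  h₂ h₁

/-- **D2 TRANSFER TO THE COUPLING-RESPONSE CURRENCY (route header: "U ⇐ ResponseHolomorphyOnePlanes for canon")**:
`k`-uniform bounds `C₀ C₁ⁿ n!` on all real derivatives at `0` of the anisotropic order-one tilted responses of the
SELF-NORMALISED scheme, for simple `G` under U_RS's hypotheses.  Strictly STRONGER than U_RS (the `n`-th derivative is
the joint cumulant with `n` insertions of ONE modulating field: repeated insertions in one region, i.e. contact terms). [folklore] -/
def CanonResponseDerivBounds : Prop :=
  open Literature.MathematicalPhysics.QuantumLattice Literature.MathematicalPhysics.AQFT Literature.MathematicalPhysics.QuantumFieldTheory in let E := EuclideanSpace ℝ (Fin 4); ∀ (G : Type) [Group G] [TopologicalSpace G] [IsTopologicalGroup G] [CompactSpace G] [MeasurableSpace G] [BorelSpace G], IsCompactSimpleLieGroup G → ∀ (r : LatticeRep G) (sch : SpeciesScheme (YMSpecies G)) (u : SchwartzMap E ℝ) (p : ℕ) (M : ℝ), let bare : SpeciesScheme (YMSpecies G) := { sch with c := fun _ _ => 1, m := fun _ _ => 0 }; let T : SchwartzMap E ℝ → ℕ → ℝ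 := fun w k => latticeSchwinger r.ρ bare (fun s => s.F) k (1 + 1) (fun _ => r.curvature) ![w, thetaTest 4 w] - latticeSchwinger r.ρ bare (fun s => s.F) k 1 (fun _ => r.curvature) ![w] * latticeSchwinger r.ρ bare (fun s => s.F) k 1 (fun _ => r.curvature) ![thetaTest 4 w]; let canon : SpeciesScheme (YMSpecies G) := { sch with c := fun _ k => (Real.sqrt (T u k))⁻¹, m := fun _ k => ∫ U, r.curvature.F (torusLift (sch.side k) U) ∂(wilsonMeasure r.ρ (sch.β k)) }; sch.HasWeakCouplingLimit → (∃ N : ℕ, 1 ≤ N ∧ ∀ᶠ k in Filter.atTop, (sch.a k)⁻¹ ≤ (sch.a k * (sch.L k : ℝ)) ^ N) → tsupport u ⊆ {y : E | y 0 < 0} → (∀ᶠ k in Filter.atTop, (sch.a k) ^ p ≤ T u k ∧ T u k ≤ M * T (timeShiftTest 4 (-1) u) k) → Summit.QuantumFields.YangMills.Cruxes.HypercubicLimit.CouplingResponse.ResponseDerivBoundsPlanes r canon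

/-- **D2 is a one-stub transfer**: `CanonResponseDerivBounds → U_RS` by the landed `stub_derivToMomentsPlanes`
(derivatives ⇒ moments, plane-resolved; Cauchy/polarisation bookkeeping), read at the scheme `canon`. [folklore] -/
theorem selfNormalisedMomentBoundsRS_of_canonResponseDerivBounds (h : CanonResponseDerivBounds) :
    SelfNormalisedMomentBoundsRS := by
  intro G _ _ _ _ _ _ hG r sch u p M bare T canon hw hpv hu hfw
  exact stub_derivToMomentsPlanes G r canon (h G hG r sch u p M hw hpv hu hfw)

end Summit.QuantumFields.YangMills.Cruxes.SelfNormalisedMomentBoundsR.Strategist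

end
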